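import Mathlib
import HarnessLib
/-!
# The finite-`m̃` drain-orbit family of the ℓ-reduced class-E closure and the no-reversal corollary

HONEST FRAMING (cell ns-blowup GROUP B «PROFILE SEARCH», zone Z6 «Elgindi-type C^{1,α} no-swirl self-similar blow-up»; human
rulings D-0035/D-0074/D-0081): sibling of `ElgindiDrainMatching` (profile-eng-9 g3) and `ElgindiDrainClosure` (profile-eng-10 g5).
Elementary real analysis / algebra about the TWO-ODE DRAIN CLOSURE of the ℓ-REDUCED ν = 0 axisymmetric NO-SWIRL **EULER** class-E
profile equation at FINITE `ε = 1/(1+δ)` (HOME/profile/z6/pen/limit/LIMIT-THEORY-A.md §5b). A MODEL of a MODEL of a MODEL;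
«violates: none — MODEL (Euler)»; nothing about Navier–Stokes and nothing about existence of profiles.

At finite `ε` the exact axis law of the reduced model keeps the corner speed `m̃ = εμ` in the denominator and the local-flux
coefficient `p = 1/2 − α/3` in the numerator: `d ln γ/dS = [μ − 4CΛ − pγ]/(m̃ + 4αΛ)`, `dΛ/dS = γ/(4α)`, hence the orbit equation
`(m̃ + 4αΛ)·γ′(Λ) = 4α(μ − 4CΛ − pγ)`. Its solutions are `A + BΛ + K(m̃ + 4αΛ)^{−p}` with `B = −4C/(1 + p)`,
`A = (4αμ − m̃B)/(4αp)` — the `ε → 0` case (`m̃ = 0`, `α = 1/2`, `p = 1/3`) is `ElgindiDrainClosure.drainOrbit_general`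
(`A = 3μ`, `B = −3C`, `K(2Λ)^{−1/3}`). This is the form used for the finite-`δ` full-model ∥ reduced comparison of
HOME/profile/z6/pen/limit/LIMIT-THEORY-A.md §5b. MODEL³ algebra/calculus; nothing about NS. -/

open Real Set

namespace Summit.NavierStokesRegularity.OSWSelfSimilar
namespace ElgindiDrainMatchingFinite

/-- **Finite-`m̃` orbit family solves the exact-axis-law orbit equation.** With `p ≠ 0`, `p ≠ −1`, `α ≠ 0`, `B = −4C/(1+p)`,
`A = (4αμ − m̃B)/(4αp)` and `0 < m̃ + 4αΛ`, the function `γ(Λ) = A + BΛ + K(m̃ + 4αΛ)^{−p}` satisfies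
`(m̃ + 4αΛ)γ′ = 4α(μ − 4CΛ − pγ)`. [new here — MODEL closure calculus at finite ε; LIMIT-THEORY-A §5b] -/
theorem drainOrbit_finite_solves {α μ C p m K Λ : ℝ} (hp : p ≠ 0) (hp1 : 1 + p ≠ 0) (hα : α ≠ 0)
    (hpos : 0 < m + 4 * α * Λ) :
    let B := -4 * C / (1 + p)
    let A := (4 * α * μ - m * B) / (4 * α * p)
    HasDerivAt (fun L : ℝ => A + B * L + K * (m + 4 * α * L) ^ (-p))
        (B + K * (4 * α * (-p) * (m + 4 * α * Λ) ^ (-p - 1))) Λ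
      ∧ (m + 4 * α * Λ) * (B + K * (4 * α * (-p) * (m + 4 * α * Λ) ^ (-p - 1)))
          = 4 * α * (μ - 4 * C * Λ - p * (A + B * Λ + K * (m + 4 * α * Λ) ^ (-p))) := by
  intro B A
  have hlin : HasDerivAt (fun L : ℝ => m + 4 * α * L) (4 * α) Λ := by
    simpa using ((hasDerivAt_id' Λ).const_mul (4 * α)).const_add m
  constructor
  · have h1 : HasDerivAt (fun L : ℝ => A + B * L) B Λ := by
      simpa using ((hasDerivAt_id' Λ).const_mul B).const_add A
    have h2 := (hlin.rpow_const (p := -p) (Or.inl hpos.ne')).const_mul K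
    exact (h1.add h2).congr_deriv (by ring)
  · have hX : (m + 4 * α * Λ) ^ (-p) = (m + 4 * α * Λ) ^ (-p - 1) * (m + 4 * α * Λ) := by
      rw [Real.rpow_sub_one hpos.ne' (-p), div_mul_cancel₀ _ hpos.ne']
    have hA : 4 * α * p * A = 4 * α * μ - m * B := by
      simp only [A]; field_simp
    have hB : B * (1 + p) = -4 * C := by
      simp only [B]; field_simp
    rw [hX]
    linear_combination hA + 4 * α * Λ * hB

/-- **Uniqueness at finite `m̃`.** Every solution of `(m̃ + 4αΛ)γ′ = 4α(μ − 4CΛ − pγ)` on an interval `(b, c)` on which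
`m̃ + 4αΛ > 0` is `A + BΛ + K(m̃ + 4αΛ)^{−p}` for one `K` (same `A`, `B`): the product `(γ − A − BΛ)(m̃ + 4αΛ)^{p}` has zero
derivative. So at finite `ε`, exactly as at `ε = 0`, the plateau flux has ONE free constant, fixed by the matching to the trench.
[new here — MODEL closure calculus at finite ε] -/
theorem drainOrbit_finite_unique {γ γ' : ℝ → ℝ} {α μ C p m b c : ℝ} (hp : p ≠ 0) (hp1 : 1 + p ≠ 0) (hα : α ≠ 0)
    (hpos : ∀ Λ ∈ Ioo b c, 0 < m + 4 * α * Λ)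
    (hder : ∀ Λ ∈ Ioo b c, HasDerivAt γ (γ' Λ) Λ)
    (hode : ∀ Λ ∈ Ioo b c, (m + 4 * α * Λ) * γ' Λ = 4 * α * (μ - 4 * C * Λ - p * γ Λ)) :
    let B := -4 * C / (1 + p)
    let A := (4 * α * μ - m * B) / (4 * α * p)
    ∃ K : ℝ, ∀ Λ ∈ Ioo b c, γ Λ = A + B * Λ + K * (m + 4 * α * Λ) ^ (-p) := by
  intro B A
  have hA : 4 * α * p * A = 4 * α * μ - m * B := by
    simp only [A]; field_simp
  have hB : B * (1 + p) = -4 * C := by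
    simp only [B]; field_simp
  set G : ℝ → ℝ := fun L => (γ L - (A + B * L)) * (m + 4 * α * L) ^ p with hG
  have hGder : ∀ Λ ∈ Ioo b c, HasDerivAt G 0 Λ := by
    intro Λ hΛ
    have hq := hpos Λ hΛ
    have hlin : HasDerivAt (fun L : ℝ => m + 4 * α * L) (4 * α) Λ := by
      simpa using ((hasDerivAt_id' Λ).const_mul (4 * α)).const_add m
    have hlinB : HasDerivAt (fun L : ℝ => A + B * L) B Λ := by
      simpa using ((hasDerivAt_id' Λ).const_mul B).const_add A
    have h1 : HasDerivAt (fun L : ℝ => γ L - (A + B * L)) (γ' Λ - B) Λ := (hder Λ hΛ).sub hlinB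
    have h2 := hlin.rpow_const (p := p) (Or.inl hq.ne')
    refine (h1.mul h2).congr_deriv ?_
    have hP : (m + 4 * α * Λ) ^ p = (m + 4 * α * Λ) ^ (p - 1) * (m + 4 * α * Λ) := by
      rw [Real.rpow_sub_one hq.ne', div_mul_cancel₀ _ hq.ne']
    rw [hP]
    have key : (γ' Λ - B) * (m + 4 * α * Λ) + (γ Λ - (A + B * Λ)) * (4 * α * p) = 0 := by
      have h := hode Λ hΛ
      linear_combination h - hA - 4 * α * Λ * hB
    have : (γ' Λ - B) * ((m + 4 * α * Λ) ^ (p - 1) * (m + 4 * α * Λ))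
        + (γ Λ - (A + B * Λ)) * (4 * α * p * (m + 4 * α * Λ) ^ (p - 1))
        = (m + 4 * α * Λ) ^ (p - 1) * ((γ' Λ - B) * (m + 4 * α * Λ) + (γ Λ - (A + B * Λ)) * (4 * α * p)) := by
      ring
    rw [this, key, mul_zero]
  have hGdiff : DifferentiableOn ℝ G (Ioo b c) := fun Λ hΛ => (hGder Λ hΛ).differentiableAt.differentiableWithinAt
  have hGd0 : (Ioo b c).EqOn (deriv G) 0 := fun Λ hΛ => (hGder Λ hΛ).deriv
  obtain ⟨K, hK⟩ := isOpen_Ioo.exists_is_const_of_deriv_eq_zero isPreconnected_Ioo hGdiff hGd0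
  refine ⟨K, fun Λ hΛ => ?_⟩
  have hq := hpos Λ hΛ
  have hmul : (m + 4 * α * Λ) ^ p * (m + 4 * α * Λ) ^ (-p) = 1 := by
    rw [← Real.rpow_add hq]; simp
  have := congrArg (fun t => t * (m + 4 * α * Λ) ^ (-p)) (hK Λ hΛ)
  simp only [hG] at this
  rw [mul_assoc, hmul, mul_one] at this
  linarith

/-- **`ε → 0` consistency**: at `m̃ = 0`, `α = 1/2`, `p = 1/3` the finite family's coefficients are `A = 3μ`, `B = −3C`
(and `(0 + 4αΛ)^{−p} = (2Λ)^{−1/3}`), i.e. `ElgindiDrainClosure.drainOrbit_general`'s orbit. [new here — bookkeeping] -/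
theorem drainOrbit_finite_limit_coeffs (μ C : ℝ) :
    -4 * C / (1 + (1 / 3 : ℝ)) = -3 * C
      ∧ (4 * (1 / 2 : ℝ) * μ - 0 * (-4 * C / (1 + (1 / 3 : ℝ)))) / (4 * (1 / 2 : ℝ) * (1 / 3 : ℝ)) = 3 * μ
      ∧ ∀ Λ : ℝ, (0 : ℝ) + 4 * (1 / 2 : ℝ) * Λ = 2 * Λ := by
  refine ⟨by norm_num; ring, by norm_num; ring, fun Λ => by ring⟩

/-- **No characteristic reversal on the matched law (closure-level answer to P-Z6-10's second clause).** The normalised axis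
corner speed is `μ = m̃/ε = m_char = 2C − 1 + 2Cε` (from `m̃ = 1 − 2α(1 + ε)`, `α = 1/2 − Cε`); whenever `C > 2/3` (which the
matched mass relation forces at every `ε > 0`, `ElgindiDrainMatching.drainConstant_gt_two_thirds_of_matching`) and `ε > 0`, one has
`m_char > 1/3 + (4/3)ε > 0` — the branch stays on the pure-inflow side of the reversal line at every finite `δ`, with
`m_char → 1/3`. [new here — MODEL³ algebra; LIMIT-THEORY-A §2] -/
theorem cornerSpeed_gt_third_of_matching {C ε : ℝ} (hC : 2 / 3 < C) (hε : 0 < ε) :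
    1 - 2 * (1 / 2 - C * ε) * (1 + ε) = ε * (2 * C - 1 + 2 * C * ε)
      ∧ 1 / 3 + 4 / 3 * ε < 2 * C - 1 + 2 * C * ε ∧ 0 < 2 * C - 1 + 2 * C * ε := by
  refine ⟨by ring, ?_, ?_⟩
  · nlinarith [mul_pos (by linarith : (0:ℝ) < C - 2 / 3) hε]
  · nlinarith [mul_pos (by linarith : (0:ℝ) < C) hε]


end ElgindiDrainMatchingFinite
end Summit.NavierStokesRegularity.OSWSelfSimilar
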